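import Mathlib.LinearAlgebra.LinearIndependent.Lemmas
import Mathlib.RingTheory.IntegralDomain                                          -- Mathlib ★ `linearIndependent_monoidHom` (Dedekind–Artin)
import Mathlib.Algebra.Group.Subgroup.Lattice
import Mathlib.Data.Complex.Basic
import HarnessLib

/-!
# F0 · P3c · line LH6 «StCharTS» — brick «ARTIN-B» of organ (S-i): DISTINCT CHARACTERS OF A GROUP ARE LINEARLY INDEPENDENT ON ANY GENERATING
# SUBSEMIGROUP (Dedekind–Artin on the monoid `B ∪ {1}`, shifted by an element of `B`)

Cell `pub/hodgecm-mathlib`, crux H413 = `stmt-HodgeConjecture-24833` (lane `--supports … --as helper`), route HCCMUnconditional; seat LH6-p02 (g0), organ (S-i)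
`stub_StNoncuspidalMember` of `Cruxes/H413/Lines/F0_P3c_StCharTSPaydown.lean` ED. 1 (:297).  THEOREMS ONLY, sorry-free, Mathlib-only, generic.
HONEST LABEL: HC_CM is proved only modulo the printed citations (2 remaining named inputs hLiu418 24832, h413 24833) until rung 0 closes; this is the «linear
independence of characters of `M`» step of [Rogawski1990, proof of L. 12.7.3 p. 195] in the shape the SHELL road needs: the shell identities (★ R2d
`Representation.smoothTrace_indicator_shell_eq`) hold only for STRICTLY DOMINANT torus elements `b` — a subsemigroup `B` of `T` (central elements times
contracting rays) NOT containing `1` but generating `T` — and a relation `Σ_i c_i θ_i(b) = 0` on `B` between characters pairwise distinct on `T` already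
forces `c = 0`: shift by a fixed `b₀ ∈ B` (`b₀·(B ∪ {1}) ⊆ B`) and apply Artin's theorem (Mathlib ★ `linearIndependent_monoidHom`) to the restrictions to the
submonoid `B ∪ {1}`, which are still pairwise distinct because `B` generates `T`.  (Companion of ★ «ARTIN-S» p848296, which treats the ray set `T₀·a^{≥m₀}`.)

## References
* [Rogawski1990] J. D. Rogawski, Ann. of Math. Stud. 123 (1990): §12.7 proof of Lemma 12.7.3 p. 195 («linear independence of characters»).
* [Lang2002] S. Lang, *Algebra*, 3rd ed. (2002), VI §4 Thm. 4.1 (Artin: independence of characters).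
-/

set_option autoImplicit false
-- the mandated namespace has the single-problem summit's repeated segment (`HodgeConjecture.HodgeConjecture`)
set_option linter.dupNamespace false

noncomputable section

open scoped BigOperators

namespace Summit.HodgeConjecture.HodgeConjecture.Cruxes.H413.F0P3cStCharTSArtinMonoid

variable {T : Type*} [Group T] {ι : Type*} [Fintype ι]

omit [Fintype ι] in
/-- The submonoid generated by a subsemigroup `B` is `B ∪ {1}`. [folklore] -/
private theorem mem_closure_subsemigroup_iff (B : Subsemigroup T) (s : T) :
    s ∈ Submonoid.closure (B : Set T) ↔ s = 1 ∨ s ∈ B := by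
  constructor
  · intro hs
    induction hs using Submonoid.closure_induction with
    | mem x hx => exact Or.inr hx
    | one => exact Or.inl rfl
    | mul x y _ _ ihx ihy =>
      rcases ihx with rfl | hx
      · rw [one_mul]; exact ihy
      · rcases ihy with rfl | hy
        · rw [mul_one]; exact Or.inr hx
        · exact Or.inr (B.mul_mem hx hy)
  · rintro (rfl | hs)
    · exact Submonoid.one_mem _
    · exact Submonoid.subset_closure hs

/-- **«ARTIN-B»: characters pairwise distinct on `T` are linearly independent on any generating subsemigroup `B`.**  If `Σ_i c_i θ_i(b) = 0` for every `b` in a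
non-empty subsemigroup `B ⊆ T` with `Subgroup.closure B = T`, then `c = 0`.  Proof: for `b₀ ∈ B`, `s ↦ Σ_i (c_i θ_i(b₀)) θ_i(s)` vanishes on the monoid `B ∪ {1}`
(`b₀ s ∈ B`); the restrictions `θ_i|_{B ∪ {1}}` are pairwise distinct monoid homomorphisms (characters agreeing on `B` agree on `T`, Mathlib ★
`MonoidHom.eq_of_eqOn_dense`), hence linearly independent (Mathlib ★ `linearIndependent_monoidHom`), so `c_i θ_i(b₀) = 0`.
[cite: Rogawski1990, §12.7 proof of Lemma 12.7.3 p. 195] [cite: Lang2002, VI §4 Thm. 4.1] -/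
theorem eq_zero_of_sum_mul_char_eq_zero_on_subsemigroup (B : Subsemigroup T) (hB : Subgroup.closure (B : Set T) = ⊤) (hne : ∃ b, b ∈ B)
    (θ : ι → (T →* ℂˣ)) (hθ : Function.Injective θ) (c : ι → ℂ)
    (h : ∀ b ∈ B, ∑ i, c i * ((θ i b : ℂˣ) : ℂ) = 0) : c = 0 := by
  classical
  obtain ⟨b₀, hb₀⟩ := hne
  -- the monoid `M₁ = B ∪ {1}` and the restricted characters, read in `ℂ`
  let M₁ : Submonoid T := Submonoid.closure (B : Set T)
  let ρ : ι → (↥M₁ →* ℂ) := fun i => (Units.coeHom ℂ).comp ((θ i).restrict M₁)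
  have hρ : ∀ (i : ι) (s : ↥M₁), ρ i s = ((θ i (s : T) : ℂˣ) : ℂ) := fun _ _ => rfl
  -- pairwise distinct
  have hρinj : Function.Injective ρ := by
    intro i j hij
    apply hθ
    refine MonoidHom.eq_of_eqOn_dense hB fun b hb => ?_
    have e := DFunLike.congr_fun hij ⟨b, Submonoid.subset_closure hb⟩
    rw [hρ, hρ] at e
    exact Units.ext e
  -- the shifted relation on `M₁`
  have hrel : ∑ i, (c i * ((θ i b₀ : ℂˣ) : ℂ)) • (⇑(ρ i) : ↥M₁ → ℂ) = 0 := by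
    funext s
    rw [Finset.sum_apply, Pi.zero_apply]
    have hbs : b₀ * (s : T) ∈ B := by
      rcases (mem_closure_subsemigroup_iff B s).1 s.2 with h1 | hs
      · rw [h1, mul_one]; exact hb₀
      · exact B.mul_mem hb₀ hs
    rw [← h _ hbs]
    refine Finset.sum_congr rfl fun i _ => ?_
    rw [Pi.smul_apply, smul_eq_mul, hρ, map_mul, Units.val_mul, mul_assoc]
  have hli := (Fintype.linearIndependent_iff.1 ((linearIndependent_monoidHom (↥M₁) ℂ).comp ρ hρinj)) _ hrel
  funext i
  have hi := hli i
  rcases mul_eq_zero.1 hi with hc | hθ0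
  · exact hc
  · exact absurd hθ0 (Units.ne_zero _)

end Summit.HodgeConjecture.HodgeConjecture.Cruxes.H413.F0P3cStCharTSArtinMonoid

end
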